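import Summits.QuantumFields.YangMills.Theorems.BalabanUVNodesN08HaarCompatibilityGuardKStepMasses
import Summits.QuantumFields.YangMills.Theorems.BalabanUVNodesN08HaarCompatibilityGuardCoreLawSU2
import Mathlib.Analysis.Real.Pi.Bounds
import Summits.QuantumFields.YangMills.Theorems.BalabanUVNodesN08OneStepExcessDensity
import Literature.MathematicalPhysics.QuantumFieldTheory.Balaban1983to89.T4LimitDensity

/-!
# BalabanUVNodes ∕ N08 — THE k-STEP a.e. BOUND ON PRINT'S ITERATED RADON–NIKODYM HISTORY MASSES AT THE SLOT, `N = 2`, WITH THE (H_K) HYPOTHESIS DISCHARGED: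
# `m_k(h,V) ≤ Π_{j<k} h(δ′)^{−n_j}(h(δ′) + (K⋆−1)·h(1∕3+δ′)^{L^{d−1}−1})^{n_j}` for `dU_k`-a.e. `V`, `K⋆` the number of part 27C, on the range `L^{d−1} ≤ 9`

WIDTH SEAT `pub-ymgap-dag-n08-w3` g5, `W-SEAT-START-LIST.md` §0 (iii); item-3 lineage part 28 = part 23 (p619156 `…GuardKStepMasses`, «modulo (H_K)») with its
hypothesis (H_K) supplied by part 27C (p627424 `…GuardCoreLawSU2.fibre_law_le_su2`, (H_K) at `N = 2` on `#non-central∕|Idx| ≤ 8∕9`, i.e. `L^{d−1} ≤ 9` by part 11's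
count — at `d = 3` the smallest admissible block size `L = 3`; larger `L` is OPEN here) — 2026-08-28.  DAG node N08 = [Balaban1985UV3] Thm 1 p. 257 + Thm 2 p. 272, (41) p. 266 (the history masses), (5) p. 256 (the extensive shape); key item K1⁷
`StabilityBAtRecordR13SepCoPH` (stmt-QuantumFields-20542, `aside`), `--supports … --as helper`.  COUNT-NEUTRAL.

WHAT THIS FILE PROVES (theorems only, 0 def; bookkeeping by name over parts 23 and 27C):
 ★★ `massRecAC_avOfPrint_le_prod_ae_su2`: for a scale datum `S₀` with `S₀.P.L^{d−1} ≤ 9` (at `d = 3`: the smallest admissible block size `L = 3` of `Stage1Params.hL`), every `k ≤ m + K`, every history `h`, every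
 `δ′ > 0` and all mass-recursion parameters `M₁, Rcol, εL, εS`:  for `dU_k`-a.e. `V`,
   `massRecAC M₁ Rcol εL εS (avOfPrint 2 S₀) k h V ≤ Π_{j<k} h(δ′)^{−n_j}·(h(δ′) + (K⋆ − 1)·h(1∕3 + δ′)^{L^{d−1}−1})^{n_j}`,  `n_j = #PBond(j+1)`,
 `K⋆ = m⋆⁻¹ + 1`, `m⋆ = ((1∕9)·sin 1·q)³q²`, `q = sin(π∕3)∕(π∕3)` — NO (H_K) hypothesis left (part 23's `massRecAC_avOfPrint_le_prod_ae_of_pos` at `N = 2` fed with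
 part 27C's `fibre_law_le_su2` and `card_not_central_div_le`).
 ★★ `map_avOfPrint_le_smul_su2` (ONE step divided through: `Ū_*(dU_j) ≤ D_j • dU_{j+1}`, no (H_K)) · ★★ `TOfPrint_one_le_ae_su2` (print's own RN version: **`T1 ≤ D_j` a.e.**,
 n08-w1's density currency `ρ_j = T1`) · ★ `kstar_le` (**`K⋆ ≤ 3301`** in the kernel).
HONEST FRAMING: extensive in the FIRST (finest) coarse lattice — the product runs over all levels `j < k` with `n_j = #PBond(j+1)` (stacking); this is NOT the
k-UNIFORM letter `hmass` (`e^{c|T₁^{(k)}|}`, `c` uniform in `k`) that N08's Theorem-1 letter wants (n08-w1's (a)′ ∕ R4⁷–R4⁸ residual; `N08-ONE-STEP-BOUND-NEXT.md` §2);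
E6′ NOT decided; count-neutral; N08 NOT discharged; counts unmoved (typed 28∕28 · discharged 5∕27); one finite 𝕋⁴ programme at fixed ε — R4 closes the CONDITIONAL rung
`BalabanLadder.UV` only; the Yang–Mills mass gap (Clay) is NOT proved; nothing continuum ∕ OS.  0 `sorry`, standard axioms.
-/

noncomputable section

open MeasureTheory Function
open scoped ENNReal

namespace Summit.QuantumFields.YangMills.BalabanUVNodes.N08HaarCompatibilityGuardKStepMassesSU2

open Literature.MathematicalPhysics.QuantumFieldTheory.Balaban1983to89
open Summit.QuantumFields.Balaban3D.Carriers
open Summit.QuantumFields.Balaban3D.Proofs.MassesAC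
open Literature.MathematicalPhysics.QuantumFieldTheory.Balaban1985CMP102.Setting (Scales)
open Literature.MathematicalPhysics.QuantumFieldTheory.Balaban1983to89.B10RunsOfRecord (avOfPrint)
open Literature.MathematicalPhysics.QuantumFieldTheory.Balaban1983to89.Node00 (SU)
open Literature.MathematicalPhysics.QuantumFieldTheory.Balaban1983to89.B10RunsOfRecord (TOfPrint)
open Summit.QuantumFields.YangMills.BalabanUVNodes.N08HaarCompatibilityGuardKStepMasses (massRecAC_avOfPrint_le_prod_ae_of_pos map_avOfPrint_le_smul_of_HK
  haar_dist1_lt_ne_zero)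
open Summit.QuantumFields.YangMills.BalabanUVNodes.N08OneStepExcessDensity (rnDeriv_map_avOfPrint_ae_eq_TOfPrint_one)
open Literature.MathematicalPhysics.QuantumFieldTheory.Balaban1983to89.T4LimitDensity (rnDeriv_le_of_le_smul)
open Summit.QuantumFields.YangMills.BalabanUVNodes.N08HaarCompatibilityGuardCoreLawSU2 (fibre_law_le_su2 card_not_central_div_le mstar_pos)

variable {L : ℕ} (S : Scales L) (M₁ : ℕ) (Rcol : ℕ → ℕ) (εL εS : ℕ → ℝ)

/-- ★★ **THE k-STEP a.e. MASS BOUND AT THE SLOT, `N = 2`, (H_K) DISCHARGED** (range `L^{d−1} ≤ 9`, i.e. `L = 3` at `d = 3`; larger block sizes OPEN): for `dU_k`-a.e. `V`,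
`m_k(h,V) ≤ Π_{j<k} h(δ′)^{−n_j}(h(δ′) + (K⋆ − 1)·h(1∕3 + δ′)^{L^{d−1}−1})^{n_j}` with `K⋆ = m⋆⁻¹ + 1` the number of part 27C.  Fine-lattice-extensive (stacking),
NOT the k-uniform `hmass`. [cite: Balaban1985UV3, (41) p.266 + (5) p.256 + (2) p.256; Balaban1987RG1, (0.4) p.253 (bookkeeping — no bound of print is asserted)] -/
theorem massRecAC_avOfPrint_le_prod_ae_su2 (hL : S.P.L ^ (S.P.d - 1) ≤ 9) (k : ℕ) (hk : k ≤ S.P.m + S.P.K) {δ' : ℝ} (hδ' : 0 < δ') (h : Hist S.P k) :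
    ∀ᵐ V ∂(fieldMeasure S.P k (SU 2)), massRecAC M₁ Rcol εL εS (avOfPrint 2 S) k h V ≤
      (∏ j ∈ Finset.range k,
        (((HaarData.haar : Measure (SU 2)) {g : SU 2 | dist1 g < δ'} ^ Fintype.card (PBond S.P (j + 1)))⁻¹ *
          ((HaarData.haar : Measure (SU 2)) {g : SU 2 | dist1 g < δ'} +
              (((ENNReal.ofReal (((1 / 9 : ℝ) * Real.sin 1 * (Real.sin (Real.pi / 3) / (Real.pi / 3))) ^ 3 *
                  (Real.sin (Real.pi / 3) / (Real.pi / 3)) ^ 2))⁻¹ + 1) - 1) *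
                (HaarData.haar : Measure (SU 2)) {g : SU 2 | dist1 g < min (1 / 3) (Real.pi / (2 : ℕ)) + δ'} ^ (S.P.L ^ (S.P.d - 1) - 1)) ^
            Fintype.card (PBond S.P (j + 1)))).toReal :=
  massRecAC_avOfPrint_le_prod_ae_of_pos 2 S M₁ Rcol εL εS le_add_self
    (ENNReal.add_ne_top.2 ⟨ENNReal.inv_ne_top.2 (ENNReal.ofReal_pos.2 mstar_pos).ne', ENNReal.one_ne_top⟩) k hk
    (fun j hj c U hU => fibre_law_le_su2 (by omega) (fun c => card_not_central_div_le c hL) c U hU) hδ' h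

/-- ★★ **ONE STEP, DIVIDED THROUGH, NO (H_K)**: at the slot `N = 2`, `L^{d−1} ≤ 9`, every level `j` with `j+1 ≤ m+K` and every `δ′ > 0`:
`(avOfPrint 2)_{j*}(dU_j) ≤ D_j • dU_{j+1}`, `D_j = h(δ′)^{−n}(h(δ′) + (K⋆ − 1)·h(1∕3 + δ′)^{L^{d−1}−1})^{n}`, `n = #PBond(j+1)` (part 23's `map_avOfPrint_le_smul_of_HK` fed with 27C).
[cite: Balaban1985UV3, (2) p.256; Balaban1987RG1, (0.4) p.253 (bookkeeping — the bound is NOT in print)] -/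
theorem map_avOfPrint_le_smul_su2 (hL : S.P.L ^ (S.P.d - 1) ≤ 9) {j : ℕ} (hj : j + 1 ≤ S.P.m + S.P.K) {δ' : ℝ} (hδ' : 0 < δ') :
    (fieldMeasure S.P j (SU 2)).map (avOfPrint 2 S j).avg ≤
      (((HaarData.haar : Measure (SU 2)) {g : SU 2 | dist1 g < δ'} ^ Fintype.card (PBond S.P (j + 1)))⁻¹ *
          ((HaarData.haar : Measure (SU 2)) {g : SU 2 | dist1 g < δ'} +
              (((ENNReal.ofReal (((1 / 9 : ℝ) * Real.sin 1 * (Real.sin (Real.pi / 3) / (Real.pi / 3))) ^ 3 *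
                  (Real.sin (Real.pi / 3) / (Real.pi / 3)) ^ 2))⁻¹ + 1) - 1) *
                (HaarData.haar : Measure (SU 2)) {g : SU 2 | dist1 g < min (1 / 3) (Real.pi / (2 : ℕ)) + δ'} ^ (S.P.L ^ (S.P.d - 1) - 1)) ^
            Fintype.card (PBond S.P (j + 1))) •
        fieldMeasure S.P (j + 1) (SU 2) :=
  map_avOfPrint_le_smul_of_HK 2 S hj le_add_self
    (ENNReal.add_ne_top.2 ⟨ENNReal.inv_ne_top.2 (ENNReal.ofReal_pos.2 mstar_pos).ne', ENNReal.one_ne_top⟩)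
    (fun c U hU => fibre_law_le_su2 hj (fun c => card_not_central_div_le c hL) c U hU) (haar_dist1_lt_ne_zero 2 hδ')

/-- ★★ **THE ONE-STEP DENSITY IN PRINT'S OWN LETTER: `T1 ≤ D_j` a.e.** (print's Radon–Nikodym version `TOfPrint` of (10) along (15); n08-w1's density currency
`ρ_j = T1` a.e., `…N08OneStepExcessDensity.rnDeriv_map_avOfPrint_ae_eq_TOfPrint_one`) — at the slot `N = 2`, `L^{d−1} ≤ 9`, NO (H_K) hypothesis.
[cite: Balaban1985UV3, (2) p.256; Balaban1985Averaging, (10) p.19 (bookkeeping — no bound of print is asserted)] -/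
theorem TOfPrint_one_le_ae_su2 (hL : S.P.L ^ (S.P.d - 1) ≤ 9) {j : ℕ} (hj : j + 1 ≤ S.P.m + S.P.K) {δ' : ℝ} (hδ' : 0 < δ') :
    ∀ᵐ V ∂(fieldMeasure S.P (j + 1) (SU 2)), ENNReal.ofReal ((TOfPrint 2 S j).T 1 V) ≤
      ((HaarData.haar : Measure (SU 2)) {g : SU 2 | dist1 g < δ'} ^ Fintype.card (PBond S.P (j + 1)))⁻¹ *
          ((HaarData.haar : Measure (SU 2)) {g : SU 2 | dist1 g < δ'} +
              (((ENNReal.ofReal (((1 / 9 : ℝ) * Real.sin 1 * (Real.sin (Real.pi / 3) / (Real.pi / 3))) ^ 3 *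
                  (Real.sin (Real.pi / 3) / (Real.pi / 3)) ^ 2))⁻¹ + 1) - 1) *
                (HaarData.haar : Measure (SU 2)) {g : SU 2 | dist1 g < min (1 / 3) (Real.pi / (2 : ℕ)) + δ'} ^ (S.P.L ^ (S.P.d - 1) - 1)) ^
            Fintype.card (PBond S.P (j + 1)) := by
  haveI := HaarData.isProb (G := SU 2)
  filter_upwards [rnDeriv_le_of_le_smul (map_avOfPrint_le_smul_su2 S hL hj hδ'), rnDeriv_map_avOfPrint_ae_eq_TOfPrint_one 2 S j] with V hV hT
  rw [← hT]; exact hV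

/-- ★ **THE CONSTANT IS A NUMBER: `K⋆ = m⋆⁻¹ + 1 ≤ 3301`** (`sin 1 ≥ 5∕6`, `√3 ≥ 1.732`, `π ≤ 3.1416` give `m⋆ ≥ 1∕3300`). [folklore] -/
theorem kstar_le : ((ENNReal.ofReal (((1 / 9 : ℝ) * Real.sin 1 * (Real.sin (Real.pi / 3) / (Real.pi / 3))) ^ 3 *
      (Real.sin (Real.pi / 3) / (Real.pi / 3)) ^ 2))⁻¹ + 1 : ℝ≥0∞) ≤ 3301 := by
  set q : ℝ := Real.sin (Real.pi / 3) / (Real.pi / 3) with hq_def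
  set κ : ℝ := (1 / 9 : ℝ) * Real.sin 1 * q with hκ_def
  have hs1 : (5 / 6 : ℝ) ≤ Real.sin 1 := by
    have := Real.sin_gt_sub_cube (x := 1) one_pos; norm_num at this; linarith
  have hπ : Real.pi < 3.1416 := Real.pi_lt_d4
  have hr3 : (1.732 : ℝ) ≤ Real.sqrt 3 := by
    rw [show (1.732 : ℝ) = Real.sqrt (1.732 ^ 2) from (Real.sqrt_sq (by norm_num)).symm]
    exact Real.sqrt_le_sqrt (by norm_num)
  have hq : (0.826 : ℝ) ≤ q := by
    rw [hq_def, Real.sin_pi_div_three, le_div_iff₀ (by positivity)]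
    nlinarith
  have hκ : (0.07648 : ℝ) ≤ κ := by rw [hκ_def]; nlinarith
  have hm : (1 / 3300 : ℝ) ≤ κ ^ 3 * q ^ 2 := by
    have h1 : (0.07648 : ℝ) ^ 3 ≤ κ ^ 3 := pow_le_pow_left₀ (by norm_num) hκ 3
    have h2 : (0.826 : ℝ) ^ 2 ≤ q ^ 2 := pow_le_pow_left₀ (by norm_num) hq 2
    calc (1 / 3300 : ℝ) ≤ (0.07648 : ℝ) ^ 3 * (0.826 : ℝ) ^ 2 := by norm_num
      _ ≤ κ ^ 3 * q ^ 2 := mul_le_mul h1 h2 (by norm_num) (le_trans (by norm_num) h1)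
  have hinv : (ENNReal.ofReal (κ ^ 3 * q ^ 2))⁻¹ ≤ 3300 := by
    calc (ENNReal.ofReal (κ ^ 3 * q ^ 2))⁻¹ ≤ (ENNReal.ofReal (1 / 3300 : ℝ))⁻¹ := ENNReal.inv_le_inv.2 (ENNReal.ofReal_le_ofReal hm)
      _ = 3300 := by
          rw [one_div, ENNReal.ofReal_inv_of_pos (by norm_num), inv_inv]
          norm_num
  calc (ENNReal.ofReal (κ ^ 3 * q ^ 2))⁻¹ + 1 ≤ 3300 + 1 := add_le_add hinv le_rfl
    _ = 3301 := by norm_num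

end Summit.QuantumFields.YangMills.BalabanUVNodes.N08HaarCompatibilityGuardKStepMassesSU2

end
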